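/-
Copyright (c) 2026. All rights reserved.
Released under Apache 2.0 license as described in the file LICENSE.
Authors: abc-iut cell, seat abc-iut-w5-d053 (gen 4; rows «COR36-FULL-NV» / «COR36-FULL-NV-SLIM» — the affine
witnesses, transported to the isomorphism-closed subcategories they determine).
-/
import Literature.AnabelianGeometry.AbsoluteAnabelian.AbsTopIII.MLFGaloisModelAffineWitnessSlimProofs
import Mathlib.CategoryTheory.ObjectProperty.ClosedUnderIsomorphisms
import HarnessLib

/-!
# [AbsTopIII] Prop 3.2 (iv) / Cor 3.6 / Cor 3.7 at the MLF model: the affine witnesses on the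
# ISOMORPHISM-CLOSED subcategories they determine

S. Mochizuki, *Topics in absolute anabelian geometry III* [MochizukiAbsTopIII2015] (kurims manuscript
`paper:url-5493eb38cbb7`), Def 3.1 (iii) p. 68 ("we shall use the same notation [...] to denote the various
subcategories determined by [...]"), Prop 3.2 (iv) p. 72, Cor 3.6 pp. 78–82, Cor 3.7 pp. 86–89.

PROOF-ONLY file (seat abc-iut-w5-d053 gen 4).  The witness types `IsAffineModel` / `IsAffineModelAn` of
`MLFGaloisModelAffineWitness*.lean` are defined by EQUALITY with the constructed objects; print's
subcategories of `𝒞^MLF_TF` are "determined by" classes of objects up to isomorphism.  This file removes the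
difference: for ANY functor `F` and object property `P`, fullness of `P.ι ⋙ F` passes to the
isomorphism closure `P.isoClosure` (`full_isoClosure_of_full`, pure category theory), slimness /
centre-freeness of `Π_k` pass along Galois-isomorphisms, and hence every result of the two witness rows holds
on the ISOMORPHISM-CLOSED full subcategories `𝒳_{P₀^≅}`, `𝒳_{P₀^an,≅}` of the model category `𝒳`
(`full_galP_isoClosure_isAffineModel(An)`, `isIdRigid_isoClosure_…`, `isSlimGroup_of_isoClosure_isAffineModelAn`,
`logFrobeniusCompatible_isoClosure_isAffineModelAn`, `cor_3_7_isoClosure_isAffineModelAn`).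

HONEST FRAMING: consistency / non-vacuity witnesses for the typed hypothesis structure of the Cor 3.6 / 3.7
model column; the objects are not of strictly-Belyi type; no new `Prop` fact, no definition; nothing here
bears on [IUTchIII] Cor. 3.12; instantiated ≠ endorsed; model-level ≠ node-level.
-/

set_option autoImplicit false

noncomputable section

namespace Literature.AnabelianGeometry.AbsoluteAnabelian.AbsTopIII

open CategoryTheory
open Literature.AlgebraicGeometry.Frobenioids (IsSlimGroup)

/-! ## Pure category theory: fullness passes to the isomorphism closure -/

/-- **If `P.ι ⋙ F` is full then so is `P.isoClosure.ι ⋙ F`**: conjugate a morphism `F X ⟶ F Y` by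
`F` of the chosen isomorphisms to `P`-objects, lift there, conjugate back.  (For print's "subcategories
determined by" a class of objects, Def 3.1 (iii).) [cite: MochizukiAbsTopIII2015, Definition 3.1 (iii) p.68] -/
theorem full_isoClosure_of_full {C : Type*} [Category C] {D : Type*} [Category D] (F : C ⥤ D)
    (P : ObjectProperty C) (h : (P.ι ⋙ F).Full) : (P.isoClosure.ι ⋙ F).Full :=
  ⟨fun {X Y} g => by
    obtain ⟨X', hX', ⟨eX⟩⟩ := X.property
    obtain ⟨Y', hY', ⟨eY⟩⟩ := Y.property
    obtain ⟨f', hf'⟩ := h.map_surjective (X := ⟨X', hX'⟩) (Y := ⟨Y', hY'⟩)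
      (F.map eX.inv ≫ g ≫ F.map eY.hom)
    refine ⟨ObjectProperty.homMk (eX.hom ≫ f'.hom ≫ eY.inv), ?_⟩
    have hf'' : F.map f'.hom = F.map eX.inv ≫ g ≫ F.map eY.hom := hf'
    change F.map (eX.hom ≫ f'.hom ≫ eY.inv) = g
    simp only [Functor.map_comp, hf'', Category.assoc, Iso.map_hom_inv_id_assoc]
    erw [Iso.map_hom_inv_id, Category.comp_id]⟩

/-- Centre-freeness is transported along group isomorphisms (private helper). [folklore] -/
private theorem center_eq_bot_of_mulEquiv {G H : Type*} [Group G] [Group H] (e : G ≃* H)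
    (hG : Subgroup.center G = ⊥) : Subgroup.center H = ⊥ := by
  rw [eq_bot_iff]
  intro z hz
  rw [Subgroup.mem_center_iff] at hz
  have hz' : e.symm z ∈ Subgroup.center G := by
    rw [Subgroup.mem_center_iff]
    intro g
    apply e.injective
    rw [map_mul, map_mul, e.apply_symm_apply]
    exact hz (e g)
  rw [hG, Subgroup.mem_bot] at hz'
  rw [Subgroup.mem_bot, ← e.apply_symm_apply z, hz', map_one]

namespace TFModel

variable {p : ℕ} [hp : Fact p.Prime]

/-! ## The isomorphism-closed subcategories `𝒳_{P₀^≅}`, `𝒳_{P₀^an,≅}` determined by the affine witnesses -/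

/-- Every object of the isomorphism closure of `P₀^an` has SLIM `Π_k` (slimness passes along the Galois
component `φ_Π` of an isomorphism of `𝒳`). [cite: MochizukiAbsTopIII2015, Proposition 3.2 (iv) p.72] -/
theorem isSlimGroup_of_isoClosure_isAffineModelAn {A : TFModel p}
    (hA : (IsAffineModelAn (p := p)).isoClosure A) : IsSlimGroup A.pair.Pi := by
  obtain ⟨B, hB, ⟨e⟩⟩ := hA
  exact isSlimGroup_of_continuousMulEquiv (Hom.piIso (e.inv : Hom B A)) (isSlimGroup_of_isAffineModelAn hB)

/-- Every object of the isomorphism closure of `P₀` has CENTRE-FREE `Π_k`.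
[cite: MochizukiAbsTopIII2015, Proposition 3.2 (iv) p.72] -/
theorem center_eq_bot_of_isoClosure_isAffineModel {A : TFModel p}
    (hA : (IsAffineModel (p := p)).isoClosure A) : Subgroup.center A.pair.Pi = ⊥ := by
  obtain ⟨B, hB, ⟨e⟩⟩ := hA
  obtain ⟨k, _, rfl⟩ := hB
  exact center_eq_bot_of_mulEquiv (Hom.piIso (e.inv : Hom _ A)).toMulEquiv AffPi.center_eq_bot

/-- **Prop 3.2 (iv) surjectivity on the isomorphism-closed subcategory `𝒳_{P₀^≅}`.**
[cite: MochizukiAbsTopIII2015, Proposition 3.2 (iv) p.72] -/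
theorem full_galP_isoClosure_isAffineModel : (galP p (IsAffineModel (p := p)).isoClosure).Full :=
  full_isoClosure_of_full _ _ full_galP_isAffineModel

/-- **Prop 3.2 (iv) surjectivity on the isomorphism-closed subcategory `𝒳_{P₀^an,≅}`** (all objects slim).
[cite: MochizukiAbsTopIII2015, Proposition 3.2 (iv) p.72] -/
theorem full_galP_isoClosure_isAffineModelAn : (galP p (IsAffineModelAn (p := p)).isoClosure).Full :=
  full_isoClosure_of_full _ _ full_galP_isAffineModelAn

/-- `𝒳_{P₀^≅}` is id-rigid (centre-free route). [cite: MochizukiAbsTopIII2015, Proposition 3.2 (iv) p.72] -/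
theorem isIdRigid_isoClosure_isAffineModel : IsIdRigid (IsAffineModel (p := p)).isoClosure.FullSubcategory :=
  isIdRigid_fullSubcategory_of_center_eq_bot _ fun _ h => center_eq_bot_of_isoClosure_isAffineModel h

/-- `𝒳_{P₀^an,≅}` is id-rigid (abc-iut-L4-t9's slim route verbatim).
[cite: MochizukiAbsTopIII2015, Proposition 3.2 (iv) p.72] -/
theorem isIdRigid_isoClosure_isAffineModelAn : IsIdRigid (IsAffineModelAn (p := p)).isoClosure.FullSubcategory :=
  isIdRigid_fullSubcategory_of_slim _ fun _ h => isSlimGroup_of_isoClosure_isAffineModelAn h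

/-- The isomorphism closures are closed under isomorphisms (Mathlib) and nonempty.
[cite: MochizukiAbsTopIII2015, Definition 3.1 (iii) p.68] -/
theorem nonempty_isoClosure_isAffineModelAn_fullSubcategory :
    (IsAffineModelAn (p := p)).isoClosure.IsClosedUnderIsomorphisms ∧
      Nonempty (IsAffineModelAn (p := p)).isoClosure.FullSubcategory :=
  ⟨inferInstance, ⟨⟨affineModelAn ⊥, (IsAffineModelAn (p := p)).le_isoClosure _ (isAffineModelAn_affineModelAn ⊥)⟩⟩⟩

/-- The Cor-1.10 datum over the slim, isomorphism-closed, nonempty sub-model `𝒳_{P₀^an,≅}` is inhabited.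
[cite: MochizukiAbsTopIII2015, Corollary 3.6 (ii) p.79] -/
theorem nonempty_anabelianInput_isoClosure_isAffineModelAn :
    Nonempty (AnabelianInput p (IsAffineModelAn (p := p)).isoClosure
      (IsAffineModelAn (p := p)).isoClosure.FullSubcategory) :=
  (nonempty_anabelianInput_iff_full p _).2 full_galP_isoClosure_isAffineModelAn

/-- **[AbsTopIII] Cor 3.6 (i)–(v) at `𝒳_{P₀^an,≅}`** (abc-iut-L4-t5's `logFrobeniusCompatible_model_of_full`
verbatim: fullness, slimness, base object supplied). [cite: MochizukiAbsTopIII2015, Corollary 3.6 (i)–(v) pp.78–82] -/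
theorem logFrobeniusCompatible_isoClosure_isAffineModelAn :
    (monoAnabelianData (AnabelianInput.ofFull p (IsAffineModelAn (p := p)).isoClosure
        full_galP_isoClosure_isAffineModelAn)).toLogFrobeniusData.LogFrobeniusCompatible
      (monoAnabelianData (AnabelianInput.ofFull p (IsAffineModelAn (p := p)).isoClosure
        full_galP_isoClosure_isAffineModelAn)).telecoreData :=
  logFrobeniusCompatible_model_of_full full_galP_isoClosure_isAffineModelAn
    (fun _ h => isSlimGroup_of_isoClosure_isAffineModelAn h)
    ⟨affineModelAn ⊥, (IsAffineModelAn (p := p)).le_isoClosure _ (isAffineModelAn_affineModelAn ⊥)⟩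

/-- **[AbsTopIII] Cor 3.7 (i)–(v) at `𝒳_{P₀^an,≅}`** (abc-iut-L4-t9's `model_of_cor_3_7_of_full` verbatim).
[cite: MochizukiAbsTopIII2015, Corollary 3.7 (i)–(v) pp.86–89] -/
theorem cor_3_7_isoClosure_isAffineModelAn :
    ((modelSetting p).restrict (IsAffineModelAn (p := p)).isoClosure fun _ h => h).Cor_3_7_i ∧
      ((modelSetting p).restrict (IsAffineModelAn (p := p)).isoClosure fun _ h => h).Cor_3_7_ii
        (biAnabelianLiftOfFull p _ full_galP_isoClosure_isAffineModelAn) ∧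
      Literature.AnabelianGeometry.AbsoluteAnabelian.AbsTopIII.BiAnabelianSetting.Cor_3_7_iii
        ((modelSetting p).restrict (IsAffineModelAn (p := p)).isoClosure fun _ h => h) ∧
      ((modelSetting p).restrict (IsAffineModelAn (p := p)).isoClosure fun _ h => h).Cor_3_7_iv
        (biAnabelianLiftOfFull p _ full_galP_isoClosure_isAffineModelAn) ∧
      ((modelSetting p).restrict (IsAffineModelAn (p := p)).isoClosure fun _ h => h).Cor_3_7_v :=
  model_of_cor_3_7_of_full p _ (fun _ h => isSlimGroup_of_isoClosure_isAffineModelAn h) (affineModelAn ⊥)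
    ((IsAffineModelAn (p := p)).le_isoClosure _ (isAffineModelAn_affineModelAn ⊥))
    full_galP_isoClosure_isAffineModelAn

end TFModel

end Literature.AnabelianGeometry.AbsoluteAnabelian.AbsTopIII

end
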